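import Mathlib.Analysis.Calculus.ContDiff.Bounds
import Mathlib.Analysis.SpecialFunctions.SmoothTransition
import Mathlib.Algebra.Ring.GeomSum
import Mathlib.Analysis.Real.Pi.Bounds
import Literature.Analysis.Fourier.SmoothProfileExpSums
import HarnessLib

/-!
# Autocorrelation bumps `|Σ_ν s(ν/t) e^{iνθ}|² / (Σ_ν s(ν/t))²`: flatness, tails, lower bounds

Topic `Literature/Analysis/Fourier`.  For a REAL nonnegative profile `s` the normalised autocorrelation
`A_{s,t}(θ) = |V_{s,t}(θ)|²/V_{s,t}(0)²`, `V_{s,t}(θ) = Σ_{ν=0}^t s(ν/t) e^{iνθ}`, is an even trigonometric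
polynomial of degree `t` with values in `[0,1]`, equal to `1` at `θ = 0`, and with nonnegative cosine
coefficients `s(ν/t)s(ν'/t)` at frequency `ν − ν'` (`norm_sq_profSum_cprof`).  This is the positivity
mechanism `W_t = |κ_t|² ≥ 0` of Bauerschmidt's finite-range polynomials [Bauerschmidt2013, Lemma 2.3 and §3.1]
(Buchholz 2018, Lemma 5.1: `W_t(λ) = Σ_n φ(…)`, `φ = |κ|²`), realised without Poisson summation.  We prove:

* `acBump_nonneg`, `acBump_le_one`, `acBump_zero` and the FLATNESS bound `1 − A_{s,t}(θ) ≤ (tθ)²/2`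
  (`one_sub_acBump_le`);
* the LOWER bound for the box profile (`A_{𝟙,m}` = normalised Fejér kernel `F_m(θ)/(m+1)`):
  `1 − A_{𝟙,m}(θ) ≥ min(((m+1)θ)²/(4π²), 2/5)` for `m ≥ 1`, `0 < θ ≤ π/2` (`one_sub_acBump_box_ge`) — the
  discrete counterpart of `W_t(λ) ≥ ε` for `λ ≤ B min(1,t⁻²)` [Buchholz2016, Lemma 5.1 (5.4)]; via the
  variance identity `Σ_{ν,ν'≤m}(ν−ν')² = m(m+1)²(m+2)/6` and the geometric-sum bound `|D_m(θ)| ≤ 1/|sin(θ/2)|`;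
* DERIVATIVE bounds (the symbol estimates (5.3) of [Buchholz2016, Lemma 5.1] in the angle variable):
  `|A^{(n)}_{s,t}(θ)| ≤ 2^n t^n` for every nonnegative profile (`abs_iteratedDeriv_acBump_le`), and for a smooth
  profile vanishing off `[0,1]` with mass `Σ_ν s(ν/t) ≥ κ t` the tail bound
  `|A^{(n)}_{s,t}(θ)| ≤ C t^n (t|θ|)^{-j}` (`exists_abs_iteratedDeriv_acBump_le_tail`);
* the concrete smooth plateau profile `plateau` (`= 1` on `[1/4,3/4]`, `= 0` off `(0,1)`) with
  `profMass plateau t ≥ t/4` for `t ≥ 2` (`profMass_plateau_ge`).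

Everything is proved; no named facts.

## References
* R. Bauerschmidt, Probab. Theory Relat. Fields 157 (2013), Lemma 2.3, §3.1 [Bauerschmidt2013].
* S. Buchholz, J. Funct. Anal. 275 (2018), Lemma 5.1 (5.2)–(5.4) [Buchholz2016].
-/

noncomputable section

open Finset Complex
open scoped Real ComplexConjugate

namespace Literature.Analysis.Fourier

/-! ## Real profiles, mass and the autocorrelation bump -/

/-- A real profile viewed as a complex one. [cite: Buchholz2016, Lemma 5.1 (proof)] -/
def cprof (s : ℝ → ℝ) : ℝ → ℂ := fun x => ((s x : ℝ) : ℂ)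

/-- The mass `V_{s,t}(0) = Σ_{ν=0}^t s(ν/t)`. [cite: Buchholz2016, Lemma 5.1 (proof)] -/
def profMass (s : ℝ → ℝ) (t : ℕ) : ℝ := ∑ ν ∈ Finset.Icc (0 : ℤ) t, s ((ν : ℝ) / t)

/-- The normalised autocorrelation bump `A_{s,t}(θ) = |V_{s,t}(θ)|² / V_{s,t}(0)²` — the square structure
`W = |κ|²` that makes Bauerschmidt's polynomials nonnegative. [cite: Bauerschmidt2013, Lemma 2.3] -/
def acBump (s : ℝ → ℝ) (t : ℕ) (θ : ℝ) : ℝ := ‖profSum (cprof s) t 0 θ‖ ^ 2 / profMass s t ^ 2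

/-- Sums over `Icc (0:ℤ) t` are sums over `range (t+1)`. [folklore] -/
private theorem sum_Icc_int_eq_sum_range {M : Type*} [AddCommMonoid M] (F : ℤ → M) (t : ℕ) :
    ∑ ν ∈ Finset.Icc (0 : ℤ) t, F ν = ∑ ν ∈ Finset.range (t + 1), F ν := by
  refine Finset.sum_nbij' (fun ν => ν.toNat) (fun n => (n : ℤ)) ?_ ?_ ?_ ?_ ?_
  · intro ν hν; rw [Finset.mem_Icc] at hν; rw [Finset.mem_range]; omega
  · intro n hn; rw [Finset.mem_range] at hn; rw [Finset.mem_Icc]; omega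
  · intro ν hν; rw [Finset.mem_Icc] at hν; exact Int.toNat_of_nonneg hν.1
  · intro n _; simp
  · intro ν hν; rw [Finset.mem_Icc] at hν; rw [Int.toNat_of_nonneg hν.1]

/-- `V_{s,t}(0) = Σ_ν s(ν/t)`. [cite: Buchholz2016, Lemma 5.1 (proof)] -/
theorem profSum_cprof_zero (s : ℝ → ℝ) (t : ℕ) : profSum (cprof s) t 0 0 = (profMass s t : ℂ) := by
  unfold profSum profMass cprof
  push_cast
  exact sum_congr rfl fun _ _ => by simp

/-- `‖V^{(r)}_{s,t}(θ)‖ ≤ t^r V_{s,t}(0)` for a nonnegative profile. [cite: Buchholz2016, Lemma 5.1 (5.3), n = 0] -/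
theorem norm_profSum_cprof_le {s : ℝ → ℝ} (hs : ∀ x, 0 ≤ s x) (t r : ℕ) (θ : ℝ) :
    ‖profSum (cprof s) t r θ‖ ≤ (t : ℝ) ^ r * profMass s t := by
  refine (norm_profSum_le (cprof s) t r θ).trans (le_of_eq ?_)
  unfold profMass cprof
  congr 1
  refine sum_congr rfl fun ν _ => ?_
  rw [Complex.norm_real, Real.norm_eq_abs, abs_of_nonneg (hs _)]

/-- The mass of a nonnegative profile is nonnegative. [cite: Buchholz2016, Lemma 5.1 (proof)] -/
theorem profMass_nonneg {s : ℝ → ℝ} (hs : ∀ x, 0 ≤ s x) (t : ℕ) : 0 ≤ profMass s t :=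
  sum_nonneg fun _ _ => hs _

/-- `0 ≤ A_{s,t}`. [cite: Bauerschmidt2013, Lemma 2.3] -/
theorem acBump_nonneg (s : ℝ → ℝ) (t : ℕ) (θ : ℝ) : 0 ≤ acBump s t θ := by
  unfold acBump; positivity

/-- `A_{s,t} ≤ 1` for a nonnegative profile (`|Σ s_ν e^{iνθ}| ≤ Σ s_ν`). [cite: Bauerschmidt2013, Lemma 2.3] -/
theorem acBump_le_one {s : ℝ → ℝ} (hs : ∀ x, 0 ≤ s x) (t : ℕ) (θ : ℝ) : acBump s t θ ≤ 1 := by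
  unfold acBump
  have h := norm_profSum_cprof_le hs t 0 θ
  rw [pow_zero, one_mul] at h
  rcases eq_or_lt_of_le (profMass_nonneg hs t) with h0 | h0
  · rw [← h0]; simp
  · rw [div_le_one (by positivity)]
    exact pow_le_pow_left₀ (norm_nonneg _) h 2

/-- `A_{s,t}(0) = 1` when the mass is positive. [cite: Bauerschmidt2013, Lemma 2.3] -/
theorem acBump_zero {s : ℝ → ℝ} {t : ℕ} (h0 : 0 < profMass s t) : acBump s t 0 = 1 := by
  unfold acBump
  rw [profSum_cprof_zero, Complex.norm_real, Real.norm_eq_abs, abs_of_pos h0, div_self (by positivity)]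

/-! ## The cosine representation and flatness -/

/-- For a real profile, `V_{s,t}(-θ) = conj V_{s,t}(θ)`. [cite: Bauerschmidt2013, Lemma 2.3] -/
theorem profSum_cprof_neg (s : ℝ → ℝ) (t : ℕ) (θ : ℝ) :
    profSum (cprof s) t 0 (-θ) = conj (profSum (cprof s) t 0 θ) := by
  unfold profSum cprof
  rw [map_sum]
  refine sum_congr rfl fun ν _ => ?_
  simp only [pow_zero, mul_one, map_mul, Complex.conj_ofReal, ← Complex.exp_conj, Complex.conj_I,
    map_intCast, Complex.ofReal_neg]
  ring_nf

/-- `A_{s,t}(θ) = Re(V(θ) V(-θ)) / V(0)²` for a real profile. [cite: Bauerschmidt2013, Lemma 2.3] -/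
theorem acBump_eq_re (s : ℝ → ℝ) (t : ℕ) (θ : ℝ) :
    acBump s t θ = (profSum (cprof s) t 0 θ * profSum (cprof s) t 0 (-θ)).re / profMass s t ^ 2 := by
  unfold acBump
  rw [profSum_cprof_neg, Complex.mul_conj, ← Complex.normSq_eq_norm_sq]
  norm_cast

/-- **Cosine representation**: `|V_{s,t}(θ)|² = Σ_{ν,ν'} s(ν/t) s(ν'/t) cos((ν−ν')θ)` — an even trigonometric
polynomial with NONNEGATIVE coefficients when `s ≥ 0`. [cite: Bauerschmidt2013, Lemma 2.3] -/
theorem norm_sq_profSum_cprof (s : ℝ → ℝ) (t : ℕ) (θ : ℝ) :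
    ‖profSum (cprof s) t 0 θ‖ ^ 2 = ∑ ν ∈ Finset.Icc (0 : ℤ) t, ∑ ν' ∈ Finset.Icc (0 : ℤ) t,
      s ((ν : ℝ) / t) * s ((ν' : ℝ) / t) * Real.cos (((ν : ℝ) - ν') * θ) := by
  have h1 : ‖profSum (cprof s) t 0 θ‖ ^ 2 =
      (profSum (cprof s) t 0 θ * conj (profSum (cprof s) t 0 θ)).re := by
    rw [Complex.mul_conj, Complex.ofReal_re, Complex.normSq_eq_norm_sq]
  rw [h1, ← profSum_cprof_neg]
  unfold profSum cprof
  rw [sum_mul_sum, Complex.re_sum]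
  refine sum_congr rfl fun ν _ => ?_
  rw [Complex.re_sum]
  refine sum_congr rfl fun ν' _ => ?_
  simp only [pow_zero, mul_one]
  have hexp : cexp (I * (ν : ℂ) * (θ : ℂ)) * cexp (I * (ν' : ℂ) * ((-θ : ℝ) : ℂ)) =
      cexp (((((ν : ℝ) - ν') * θ : ℝ) : ℂ) * I) := by
    rw [← Complex.exp_add]; congr 1; push_cast; ring
  calc (((s ((ν : ℝ) / t) : ℝ) : ℂ) * cexp (I * (ν : ℂ) * (θ : ℂ)) *
        ((((s ((ν' : ℝ) / t)) : ℝ) : ℂ) * cexp (I * (ν' : ℂ) * ((-θ : ℝ) : ℂ)))).re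
      = ((((s ((ν : ℝ) / t) * s ((ν' : ℝ) / t) : ℝ)) : ℂ) *
          (cexp (I * (ν : ℂ) * (θ : ℂ)) * cexp (I * (ν' : ℂ) * ((-θ : ℝ) : ℂ)))).re := by
        congr 1; push_cast; ring
    _ = s ((ν : ℝ) / t) * s ((ν' : ℝ) / t) * Real.cos (((ν : ℝ) - ν') * θ) := by
        rw [hexp, Complex.re_ofReal_mul, Complex.exp_ofReal_mul_I_re]

/-- **Flatness at the origin**: `V(0)² − |V(θ)|² ≤ (tθ)²/2 · V(0)²`, since `1 − cos((ν−ν')θ) ≤ (tθ)²/2`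
for `ν, ν' ∈ [0,t]` (the origin of `W_t(λ) ≈ W_t(0)` for `λ t² ≲ 1`). [cite: Buchholz2016, Lemma 5.1 (5.4)] -/
theorem profMass_sq_sub_norm_sq_le {s : ℝ → ℝ} (hs : ∀ x, 0 ≤ s x) (t : ℕ) (θ : ℝ) :
    profMass s t ^ 2 - ‖profSum (cprof s) t 0 θ‖ ^ 2 ≤ ((t : ℝ) * θ) ^ 2 / 2 * profMass s t ^ 2 := by
  rw [norm_sq_profSum_cprof, profMass, sq, sum_mul_sum, mul_sum, ← sum_sub_distrib]
  refine sum_le_sum fun ν hν => ?_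
  rw [mul_sum, ← sum_sub_distrib]
  refine sum_le_sum fun ν' hν' => ?_
  rw [Finset.mem_Icc] at hν hν'
  have hd : |((ν : ℝ) - ν') * θ| ≤ (t : ℝ) * |θ| := by
    rw [abs_mul]
    refine mul_le_mul_of_nonneg_right ?_ (abs_nonneg _)
    rw [abs_le]
    have h1 : (0 : ℝ) ≤ ν := by exact_mod_cast hν.1
    have h2 : (ν : ℝ) ≤ t := by exact_mod_cast hν.2
    have h3 : (0 : ℝ) ≤ ν' := by exact_mod_cast hν'.1
    have h4 : (ν' : ℝ) ≤ t := by exact_mod_cast hν'.2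
    constructor <;> linarith
  have hcos : 1 - Real.cos (((ν : ℝ) - ν') * θ) ≤ ((t : ℝ) * θ) ^ 2 / 2 := by
    have h1 := Real.one_sub_sq_div_two_le_cos (x := ((ν : ℝ) - ν') * θ)
    have h2 : (((ν : ℝ) - ν') * θ) ^ 2 ≤ ((t : ℝ) * θ) ^ 2 := by
      rw [← sq_abs, ← sq_abs ((t : ℝ) * θ), abs_mul (t : ℝ), Nat.abs_cast]
      exact pow_le_pow_left₀ (abs_nonneg _) hd 2
    linarith
  have hss : 0 ≤ s ((ν : ℝ) / t) * s ((ν' : ℝ) / t) := mul_nonneg (hs _) (hs _)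
  calc s ((ν : ℝ) / t) * s ((ν' : ℝ) / t) - s ((ν : ℝ) / t) * s ((ν' : ℝ) / t) * Real.cos (((ν : ℝ) - ν') * θ)
      = s ((ν : ℝ) / t) * s ((ν' : ℝ) / t) * (1 - Real.cos (((ν : ℝ) - ν') * θ)) := by ring
    _ ≤ s ((ν : ℝ) / t) * s ((ν' : ℝ) / t) * (((t : ℝ) * θ) ^ 2 / 2) := mul_le_mul_of_nonneg_left hcos hss
    _ = ((t : ℝ) * θ) ^ 2 / 2 * (s ((ν : ℝ) / t) * s ((ν' : ℝ) / t)) := by ring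

/-- **Flatness of the bump**: `1 − A_{s,t}(θ) ≤ (tθ)²/2`. [cite: Buchholz2016, Lemma 5.1 (5.4)] -/
theorem one_sub_acBump_le {s : ℝ → ℝ} (hs : ∀ x, 0 ≤ s x) {t : ℕ} (h0 : 0 < profMass s t) (θ : ℝ) :
    1 - acBump s t θ ≤ ((t : ℝ) * θ) ^ 2 / 2 := by
  unfold acBump
  have hM2 : 0 < profMass s t ^ 2 := by positivity
  rw [show 1 - ‖profSum (cprof s) t 0 θ‖ ^ 2 / profMass s t ^ 2 =
      (profMass s t ^ 2 - ‖profSum (cprof s) t 0 θ‖ ^ 2) / profMass s t ^ 2 by field_simp,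
    div_le_iff₀ hM2]
  exact profMass_sq_sub_norm_sq_le hs t θ

/-! ## The box profile: Fejér kernel and its lower bound -/

/-- The box profile `𝟙_{[0,1]}`: `A_{𝟙,m}` is the normalised Fejér kernel `F_m(θ)/(m+1)`,
`V_{𝟙,m} = D_m` the Dirichlet kernel. [cite: Buchholz2016, Lemma 5.1 (5.4)] -/
def boxProf : ℝ → ℝ := Set.indicator (Set.Icc 0 1) 1

/-- `0 ≤ 𝟙 ≤ 1`. [cite: Buchholz2016, Lemma 5.1 (proof)] -/
theorem boxProf_nonneg (x : ℝ) : 0 ≤ boxProf x := by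
  unfold boxProf; exact Set.indicator_nonneg (fun _ _ => zero_le_one) x

/-- `𝟙(ν/m) = 1` for `0 ≤ ν ≤ m`, `m ≥ 1`. [cite: Buchholz2016, Lemma 5.1 (proof)] -/
theorem boxProf_sample {m : ℕ} (hm : 1 ≤ m) {ν : ℤ} (hν : ν ∈ Finset.Icc (0 : ℤ) m) :
    boxProf ((ν : ℝ) / m) = 1 := by
  rw [Finset.mem_Icc] at hν
  have hmpos : (0 : ℝ) < m := by exact_mod_cast hm
  have hmem : ((ν : ℝ) / m) ∈ Set.Icc (0 : ℝ) 1 := by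
    rw [Set.mem_Icc, le_div_iff₀ hmpos, div_le_iff₀ hmpos, zero_mul, one_mul]
    exact_mod_cast hν
  simp [boxProf, hmem]

/-- `V_{𝟙,m}(0) = m + 1`. [cite: Buchholz2016, Lemma 5.1 (proof)] -/
theorem profMass_boxProf {m : ℕ} (hm : 1 ≤ m) : profMass boxProf m = m + 1 := by
  unfold profMass
  rw [sum_congr rfl fun ν hν => boxProf_sample hm hν, sum_const, Int.card_Icc]
  simp only [sub_zero, nsmul_eq_mul, mul_one]
  norm_cast

/-- Power sums: `2 Σ_{ν≤m} ν = m(m+1)` and `6 Σ_{ν≤m} ν² = m(m+1)(2m+1)`. [folklore] -/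
private theorem power_sums (m : ℕ) :
    2 * ∑ ν ∈ Finset.range (m + 1), (ν : ℝ) = m * (m + 1) ∧
      6 * ∑ ν ∈ Finset.range (m + 1), (ν : ℝ) ^ 2 = m * (m + 1) * (2 * m + 1) := by
  induction m with
  | zero => simp
  | succ m ih =>
    obtain ⟨ih1, ih2⟩ := ih
    rw [Finset.sum_range_succ (fun ν : ℕ => (ν : ℝ)) (m + 1),
      Finset.sum_range_succ (fun ν : ℕ => (ν : ℝ) ^ 2) (m + 1)]
    constructor
    · rw [mul_add, ih1]; push_cast; ring
    · rw [mul_add, ih2]; push_cast; ring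

/-- **Variance identity**: `Σ_{ν,ν'=0}^m (ν − ν')² = m(m+1)²(m+2)/6`. [folklore] -/
private theorem sum_sum_sub_sq (m : ℕ) :
    ∑ ν ∈ Finset.Icc (0 : ℤ) m, ∑ ν' ∈ Finset.Icc (0 : ℤ) m, ((ν : ℝ) - ν') ^ 2 =
      (m : ℝ) * (m + 1) ^ 2 * (m + 2) / 6 := by
  rw [sum_Icc_int_eq_sum_range]
  simp_rw [sum_Icc_int_eq_sum_range (fun ν' : ℤ => (((_ : ℤ) : ℝ) - ν') ^ 2) m]
  push_cast
  have hexp : ∀ ν ν' : ℕ, ((ν : ℝ) - ν') ^ 2 = (ν : ℝ) ^ 2 - 2 * ν * ν' + (ν' : ℝ) ^ 2 := fun _ _ => by ring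
  simp_rw [hexp, sum_add_distrib, sum_sub_distrib, sum_const, card_range, nsmul_eq_mul, ← mul_sum, ← sum_mul,
    ← mul_sum]
  obtain ⟨h1, h2⟩ := power_sums m
  have e1 : ∑ ν ∈ Finset.range (m + 1), (ν : ℝ) = m * (m + 1) / 2 := by linarith
  have e2 : ∑ ν ∈ Finset.range (m + 1), (ν : ℝ) ^ 2 = m * (m + 1) * (2 * m + 1) / 6 := by linarith
  rw [e1, e2]
  push_cast
  ring

/-- **Bulk lower bound for the Fejér factor** (variance bound): for `m ≥ 1` and `m|θ| ≤ π`,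
`V(0)² − |D_m(θ)|² ≥ ((m+1)θ)²/(4π²) · V(0)²`, using `cos x ≤ 1 − (2/π²)x²` on `|x| ≤ π`.
[cite: Buchholz2016, Lemma 5.1 (5.4)] -/
theorem profMass_sq_sub_norm_sq_box_ge {m : ℕ} (hm : 1 ≤ m) {θ : ℝ} (hθ : (m : ℝ) * |θ| ≤ π) :
    (((m : ℝ) + 1) * θ) ^ 2 / (4 * π ^ 2) * profMass boxProf m ^ 2 ≤
      profMass boxProf m ^ 2 - ‖profSum (cprof boxProf) m 0 θ‖ ^ 2 := by
  rw [norm_sq_profSum_cprof, profMass_boxProf hm]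
  have hrw : ∑ ν ∈ Finset.Icc (0 : ℤ) m, ∑ ν' ∈ Finset.Icc (0 : ℤ) m,
      boxProf ((ν : ℝ) / m) * boxProf ((ν' : ℝ) / m) * Real.cos (((ν : ℝ) - ν') * θ) =
      ∑ ν ∈ Finset.Icc (0 : ℤ) m, ∑ ν' ∈ Finset.Icc (0 : ℤ) m, Real.cos (((ν : ℝ) - ν') * θ) := by
    refine sum_congr rfl fun ν hν => sum_congr rfl fun ν' hν' => ?_
    rw [boxProf_sample hm hν, boxProf_sample hm hν', one_mul, one_mul]
  rw [hrw]
  -- `(m+1)² - ΣΣ cos = ΣΣ (1 - cos) ≥ (2/π²) θ² ΣΣ (ν-ν')²`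
  have hcount : ((m : ℝ) + 1) ^ 2 = ∑ ν ∈ Finset.Icc (0 : ℤ) m, ∑ ν' ∈ Finset.Icc (0 : ℤ) m, (1 : ℝ) := by
    rw [sum_const, sum_const, Int.card_Icc, sub_zero, show ((m : ℤ) + 1) = ((m + 1 : ℕ) : ℤ) by push_cast; rfl,
      Int.toNat_natCast]
    simp only [nsmul_eq_mul, mul_one]
    push_cast
    ring
  have hkey : ∀ ν ∈ Finset.Icc (0 : ℤ) m, ∀ ν' ∈ Finset.Icc (0 : ℤ) m,
      2 / π ^ 2 * θ ^ 2 * ((ν : ℝ) - ν') ^ 2 ≤ 1 - Real.cos (((ν : ℝ) - ν') * θ) := by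
    intro ν hν ν' hν'
    rw [Finset.mem_Icc] at hν hν'
    have habs : |((ν : ℝ) - ν') * θ| ≤ π := by
      rw [abs_mul]
      have : |(ν : ℝ) - ν'| ≤ m := by
        rw [abs_le]
        have h1 : (0 : ℝ) ≤ ν := by exact_mod_cast hν.1
        have h2 : (ν : ℝ) ≤ m := by exact_mod_cast hν.2
        have h3 : (0 : ℝ) ≤ ν' := by exact_mod_cast hν'.1
        have h4 : (ν' : ℝ) ≤ m := by exact_mod_cast hν'.2
        constructor <;> linarith
      calc |(ν : ℝ) - ν'| * |θ| ≤ m * |θ| := mul_le_mul_of_nonneg_right this (abs_nonneg _)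
        _ ≤ π := hθ
    have h := Real.cos_le_one_sub_mul_cos_sq habs
    nlinarith [h]
  have hsum : 2 / π ^ 2 * θ ^ 2 * ((m : ℝ) * (m + 1) ^ 2 * (m + 2) / 6) ≤
      ∑ ν ∈ Finset.Icc (0 : ℤ) m, ∑ ν' ∈ Finset.Icc (0 : ℤ) m, (1 - Real.cos (((ν : ℝ) - ν') * θ)) := by
    rw [← sum_sum_sub_sq, mul_sum]
    refine sum_le_sum fun ν hν => ?_
    rw [mul_sum]
    exact sum_le_sum fun ν' hν' => hkey ν hν ν' hν'
  have hsplit : ∑ ν ∈ Finset.Icc (0 : ℤ) m, ∑ ν' ∈ Finset.Icc (0 : ℤ) m, (1 - Real.cos (((ν : ℝ) - ν') * θ)) =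
      ((m : ℝ) + 1) ^ 2 - ∑ ν ∈ Finset.Icc (0 : ℤ) m, ∑ ν' ∈ Finset.Icc (0 : ℤ) m,
        Real.cos (((ν : ℝ) - ν') * θ) := by
    rw [hcount, ← sum_sub_distrib]
    refine sum_congr rfl fun ν _ => ?_
    rw [← sum_sub_distrib]
  rw [hsplit] at hsum
  have hm1 : (1 : ℝ) ≤ m := by exact_mod_cast hm
  have hπ : 0 < π := Real.pi_pos
  -- `m(m+2) ≥ (3/4)(m+1)²`
  have hmm : 3 / 4 * ((m : ℝ) + 1) ^ 2 ≤ (m : ℝ) * (m + 2) := by nlinarith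
  have hθ2 : 0 ≤ θ ^ 2 := sq_nonneg θ
  calc (((m : ℝ) + 1) * θ) ^ 2 / (4 * π ^ 2) * ((m : ℝ) + 1) ^ 2
      = 2 / π ^ 2 * θ ^ 2 * (((m : ℝ) + 1) ^ 2 * (3 / 4 * ((m : ℝ) + 1) ^ 2) / 6) := by
        field_simp; ring
    _ ≤ 2 / π ^ 2 * θ ^ 2 * ((m : ℝ) * (m + 1) ^ 2 * (m + 2) / 6) := by
        have : ((m : ℝ) + 1) ^ 2 * (3 / 4 * ((m : ℝ) + 1) ^ 2) / 6 ≤ (m : ℝ) * (m + 1) ^ 2 * (m + 2) / 6 := by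
          nlinarith [sq_nonneg ((m : ℝ) + 1)]
        exact mul_le_mul_of_nonneg_left this (by positivity)
    _ ≤ _ := hsum

/-- **Geometric-sum bound for the Dirichlet kernel**: `2|sin(θ/2)| · |D_m(θ)| ≤ 2`.
[cite: Buchholz2016, Lemma 5.1 (proof)] -/
theorem abs_sin_mul_norm_dirichlet_le {m : ℕ} (hm : 1 ≤ m) (θ : ℝ) :
    2 * |Real.sin (θ / 2)| * ‖profSum (cprof boxProf) m 0 θ‖ ≤ 2 := by
  have hD : profSum (cprof boxProf) m 0 θ = ∑ ν ∈ Finset.range (m + 1), cexp (I * (θ : ℂ)) ^ ν := by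
    unfold profSum
    rw [sum_congr rfl fun ν hν => by rw [show cprof boxProf ((ν : ℝ) / m) = 1 by
      simp [cprof, boxProf_sample hm hν]]]
    rw [sum_Icc_int_eq_sum_range]
    refine sum_congr rfl fun ν _ => ?_
    rw [pow_zero, mul_one, one_mul, ← Complex.exp_nat_mul]
    push_cast
    ring_nf
  have hgeom : (∑ ν ∈ Finset.range (m + 1), cexp (I * (θ : ℂ)) ^ ν) * (cexp (I * (θ : ℂ)) - 1) =
      cexp (I * (θ : ℂ)) ^ (m + 1) - 1 := geom_sum_mul _ _
  have hn1 : ‖cexp (I * (θ : ℂ)) - 1‖ = 2 * |Real.sin (θ / 2)| := by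
    rw [Complex.norm_exp_I_mul_ofReal_sub_one, Real.norm_eq_abs, abs_mul, abs_two]
  have hn2 : ‖cexp (I * (θ : ℂ)) ^ (m + 1) - 1‖ ≤ 2 := by
    rw [← Complex.exp_nat_mul, show ((m + 1 : ℕ) : ℂ) * (I * (θ : ℂ)) = I * ((((m : ℝ) + 1) * θ : ℝ) : ℂ) by
      push_cast; ring, Complex.norm_exp_I_mul_ofReal_sub_one, Real.norm_eq_abs, abs_mul, abs_two]
    linarith [Real.abs_sin_le_one ((((m : ℝ) + 1) * θ) / 2)]
  calc 2 * |Real.sin (θ / 2)| * ‖profSum (cprof boxProf) m 0 θ‖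
      = ‖(∑ ν ∈ Finset.range (m + 1), cexp (I * (θ : ℂ)) ^ ν) * (cexp (I * (θ : ℂ)) - 1)‖ := by
        rw [norm_mul, hn1, hD, mul_comm]
    _ ≤ 2 := by rw [hgeom]; exact hn2

/-- **Tail lower bound for the Fejér factor**: for `m ≥ 1`, `0 < θ ≤ π/2` and `(m+1)θ ≥ π`,
`|D_m(θ)|² ≤ (3/5) V(0)²` (from `|D_m| ≤ 1/sin(θ/2)`, `sin x ≥ x − x³/4 ≥ 0.84 x` on `(0, π/4]` and
`(m+1)θ/2 ≥ π/2`). [cite: Buchholz2016, Lemma 5.1 (5.4)] -/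
theorem norm_sq_dirichlet_le_tail {m : ℕ} (hm : 1 ≤ m) {θ : ℝ} (hθ0 : 0 < θ) (hθ : θ ≤ π / 2)
    (hfar : π ≤ ((m : ℝ) + 1) * θ) :
    ‖profSum (cprof boxProf) m 0 θ‖ ^ 2 ≤ 3 / 5 * profMass boxProf m ^ 2 := by
  rw [profMass_boxProf hm]
  have hπ3 := Real.pi_gt_d2
  have hx0 : 0 < θ / 2 := by linarith
  have hx1 : θ / 2 ≤ 1 := by linarith [Real.pi_lt_d2]
  -- `sin(θ/2) ≥ θ/2 - (θ/2)³/6 ≥ 0.84 (θ/2)`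
  have hsin : 21 / 25 * (θ / 2) ≤ Real.sin (θ / 2) := by
    have h := Real.sin_gt_sub_cube hx0
    have hsq : (θ / 2) ^ 2 ≤ 16 / 25 := by nlinarith [Real.pi_lt_d2]
    nlinarith
  have hsin_pos : 0 < Real.sin (θ / 2) := by linarith
  have hprod : (5 : ℝ) / 3 ≤ (((m : ℝ) + 1) * Real.sin (θ / 2)) ^ 2 := by
    have h1 : 21 / 25 * (π / 2) ≤ ((m : ℝ) + 1) * Real.sin (θ / 2) := by
      calc 21 / 25 * (π / 2) ≤ 21 / 25 * (((m : ℝ) + 1) * θ / 2) := by nlinarith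
        _ = ((m : ℝ) + 1) * (21 / 25 * (θ / 2)) := by ring
        _ ≤ ((m : ℝ) + 1) * Real.sin (θ / 2) := mul_le_mul_of_nonneg_left hsin (by positivity)
    have h2 : (0 : ℝ) ≤ 21 / 25 * (π / 2) := by positivity
    have hc : (5 : ℝ) / 3 ≤ (21 / 25 * (π / 2)) * (21 / 25 * (π / 2)) := by nlinarith
    have h3 := mul_le_mul h1 h1 h2 (h2.trans h1)
    rw [sq]
    exact hc.trans h3
  have hD := abs_sin_mul_norm_dirichlet_le hm θ
  rw [abs_of_pos hsin_pos] at hD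
  -- `(m+1) sin(θ/2) ‖D‖ ≤ (m+1)`
  have h3 : (((m : ℝ) + 1) * Real.sin (θ / 2)) * ‖profSum (cprof boxProf) m 0 θ‖ ≤ (m : ℝ) + 1 := by
    have := mul_le_mul_of_nonneg_left hD (show (0 : ℝ) ≤ ((m : ℝ) + 1) / 2 by positivity)
    linarith [this]
  have h4 : ((((m : ℝ) + 1) * Real.sin (θ / 2)) * ‖profSum (cprof boxProf) m 0 θ‖) ^ 2 ≤ ((m : ℝ) + 1) ^ 2 :=
    pow_le_pow_left₀ (by positivity) h3 2
  rw [mul_pow] at h4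
  have h5 : (5 : ℝ) / 3 * ‖profSum (cprof boxProf) m 0 θ‖ ^ 2 ≤ ((m : ℝ) + 1) ^ 2 :=
    (mul_le_mul_of_nonneg_right hprod (by positivity)).trans h4
  linarith

/-- **Lower bound for the normalised Fejér kernel**: for `m ≥ 1` and `0 < θ ≤ π/2`,
`1 − A_{𝟙,m}(θ) ≥ min(((m+1)θ)²/(4π²), 2/5)` — the discrete form of `W_t ≥ ε` near the origin together with
`W_t ≤ 1 − c` away from it. [cite: Buchholz2016, Lemma 5.1 (5.4)] -/
theorem one_sub_acBump_box_ge {m : ℕ} (hm : 1 ≤ m) {θ : ℝ} (hθ0 : 0 < θ) (hθ : θ ≤ π / 2) :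
    min ((((m : ℝ) + 1) * θ) ^ 2 / (4 * π ^ 2)) (2 / 5) ≤ 1 - acBump boxProf m θ := by
  have hM : 0 < profMass boxProf m := by rw [profMass_boxProf hm]; positivity
  have hM2 : 0 < profMass boxProf m ^ 2 := by positivity
  unfold acBump
  rw [show 1 - ‖profSum (cprof boxProf) m 0 θ‖ ^ 2 / profMass boxProf m ^ 2 =
      (profMass boxProf m ^ 2 - ‖profSum (cprof boxProf) m 0 θ‖ ^ 2) / profMass boxProf m ^ 2 by field_simp,
    le_div_iff₀ hM2]
  rcases le_or_gt (((m : ℝ) + 1) * θ) π with hnear | hfar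
  · have hmθ : (m : ℝ) * |θ| ≤ π := by rw [abs_of_pos hθ0]; nlinarith
    calc min ((((m : ℝ) + 1) * θ) ^ 2 / (4 * π ^ 2)) (2 / 5) * profMass boxProf m ^ 2
        ≤ (((m : ℝ) + 1) * θ) ^ 2 / (4 * π ^ 2) * profMass boxProf m ^ 2 :=
          mul_le_mul_of_nonneg_right (min_le_left _ _) hM2.le
      _ ≤ _ := profMass_sq_sub_norm_sq_box_ge hm hmθ
  · have h := norm_sq_dirichlet_le_tail hm hθ0 hθ hfar.le
    calc min ((((m : ℝ) + 1) * θ) ^ 2 / (4 * π ^ 2)) (2 / 5) * profMass boxProf m ^ 2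
        ≤ 2 / 5 * profMass boxProf m ^ 2 := mul_le_mul_of_nonneg_right (min_le_right _ _) hM2.le
      _ ≤ _ := by linarith

/-! ## Derivative bounds -/

/-- Derivatives commute with the real part: `(Re ∘ Q)^{(n)} = Re ∘ Q^{(n)}` for smooth `Q : ℝ → ℂ`.
[folklore] -/
private theorem iteratedDeriv_re_comp : ∀ (n : ℕ) (Q : ℝ → ℂ), (∀ k : ℕ, ContDiff ℝ k Q) →
    iteratedDeriv n (fun θ => (Q θ).re) = fun θ => (iteratedDeriv n Q θ).re
  | 0, Q, _ => by simp
  | n + 1, Q, hQ => by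
    have hd : Differentiable ℝ Q := (hQ 1).differentiable (by simp)
    have hderiv : deriv (fun θ => (Q θ).re) = fun θ => (deriv Q θ).re := by
      funext θ
      exact (Complex.reCLM.hasFDerivAt.comp_hasDerivAt θ (hd θ).hasDerivAt).deriv
    have hQ' : ∀ k : ℕ, ContDiff ℝ k (deriv Q) := fun k => (hQ (k + 1)).deriv'
    rw [iteratedDeriv_succ', hderiv, iteratedDeriv_re_comp n (deriv Q) hQ', ← iteratedDeriv_succ']

/-- **Leibniz bound for the bump**: `|A^{(n)}_{s,t}(θ)| ≤ V(0)^{-2} Σ_i C(n,i) ‖V^{(i)}(θ)‖ ‖V^{(n-i)}(-θ)‖`.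
[cite: Buchholz2016, Lemma 5.1 (5.3)] -/
theorem abs_iteratedDeriv_acBump_le_sum (s : ℝ → ℝ) (t n : ℕ) (θ : ℝ) :
    |iteratedDeriv n (acBump s t) θ| ≤ (profMass s t ^ 2)⁻¹ * ∑ i ∈ Finset.range (n + 1),
      (n.choose i : ℝ) * ‖profSum (cprof s) t i θ‖ * ‖profSum (cprof s) t (n - i) (-θ)‖ := by
  set Q : ℝ → ℂ := fun θ => profSum (cprof s) t 0 θ * profSum (cprof s) t 0 (-θ) with hQ
  have hneg : ∀ k : ℕ, ContDiff ℝ k (fun θ : ℝ => profSum (cprof s) t 0 (-θ)) := fun k =>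
    (contDiff_profSum (cprof s) t 0).comp contDiff_neg
  have hQcd : ∀ k : ℕ, ContDiff ℝ k Q := fun k => (contDiff_profSum (cprof s) t 0).mul (hneg k)
  have hfun : acBump s t = fun θ => (profMass s t ^ 2)⁻¹ * (Q θ).re := by
    funext θ; rw [acBump_eq_re, hQ, div_eq_inv_mul]
  have hre_cd : ∀ k : ℕ, ContDiff ℝ k (fun θ => (Q θ).re) := fun k => Complex.reCLM.contDiff.comp (hQcd k)
  rw [hfun, iteratedDeriv_const_mul _ (hre_cd n).contDiffAt, abs_mul, abs_inv, abs_of_nonneg (sq_nonneg _)]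
  refine mul_le_mul_of_nonneg_left ?_ (by positivity)
  rw [iteratedDeriv_re_comp n Q hQcd]
  refine (Complex.abs_re_le_norm _).trans ?_
  rw [← norm_iteratedFDeriv_eq_norm_iteratedDeriv]
  have hmul := norm_iteratedFDeriv_mul_le (f := fun y => profSum (cprof s) t 0 y)
    (g := fun y => profSum (cprof s) t 0 (-y)) (contDiff_profSum (cprof s) t 0 (n := (n : WithTop ℕ∞)))
    (hneg n) θ (n := n) le_rfl
  refine hmul.trans (le_of_eq (sum_congr rfl fun i _ => ?_))
  rw [norm_iteratedFDeriv_eq_norm_iteratedDeriv, norm_iteratedFDeriv_eq_norm_iteratedDeriv,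
    iteratedDeriv_profSum, zero_add, iteratedDeriv_comp_neg, norm_smul, iteratedDeriv_profSum, zero_add,
    norm_pow, norm_neg, norm_one, one_pow, one_mul]

/-- **Trivial derivative bound**: `|A^{(n)}_{s,t}(θ)| ≤ 2^n t^n` for a nonnegative profile of positive mass
(each factor costs at most `t` per derivative). [cite: Buchholz2016, Lemma 5.1 (5.3), n = 0] -/
theorem abs_iteratedDeriv_acBump_le {s : ℝ → ℝ} (hs : ∀ x, 0 ≤ s x) {t : ℕ} (h0 : 0 < profMass s t)
    (n : ℕ) (θ : ℝ) : |iteratedDeriv n (acBump s t) θ| ≤ 2 ^ n * (t : ℝ) ^ n := by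
  refine (abs_iteratedDeriv_acBump_le_sum s t n θ).trans ?_
  have hterm : ∀ i ∈ Finset.range (n + 1), (n.choose i : ℝ) * ‖profSum (cprof s) t i θ‖ *
      ‖profSum (cprof s) t (n - i) (-θ)‖ ≤ (n.choose i : ℝ) * ((t : ℝ) ^ n * profMass s t ^ 2) := by
    intro i hi
    rw [Finset.mem_range] at hi
    have h1 := norm_profSum_cprof_le hs t i θ
    have h2 := norm_profSum_cprof_le hs t (n - i) (-θ)
    rw [mul_assoc]
    refine mul_le_mul_of_nonneg_left ?_ (by positivity)
    calc ‖profSum (cprof s) t i θ‖ * ‖profSum (cprof s) t (n - i) (-θ)‖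
        ≤ ((t : ℝ) ^ i * profMass s t) * ((t : ℝ) ^ (n - i) * profMass s t) :=
          mul_le_mul h1 h2 (norm_nonneg _) (by positivity)
      _ = (t : ℝ) ^ (i + (n - i)) * profMass s t ^ 2 := by rw [pow_add]; ring
      _ = (t : ℝ) ^ n * profMass s t ^ 2 := by rw [Nat.add_sub_cancel' (by omega)]
  calc (profMass s t ^ 2)⁻¹ * ∑ i ∈ Finset.range (n + 1),
        (n.choose i : ℝ) * ‖profSum (cprof s) t i θ‖ * ‖profSum (cprof s) t (n - i) (-θ)‖
      ≤ (profMass s t ^ 2)⁻¹ * ∑ i ∈ Finset.range (n + 1), (n.choose i : ℝ) * ((t : ℝ) ^ n * profMass s t ^ 2) :=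
        mul_le_mul_of_nonneg_left (sum_le_sum hterm) (by positivity)
    _ = (∑ i ∈ Finset.range (n + 1), (n.choose i : ℝ)) * (t : ℝ) ^ n := by
        rw [← sum_mul]; field_simp
    _ = 2 ^ n * (t : ℝ) ^ n := by
        congr 1; exact_mod_cast Nat.sum_range_choose n

/-- **Tail derivative bound**: for a smooth nonnegative profile vanishing off `[0,1]`, all `n, j` and `κ > 0`
there is `C` with `|A^{(n)}_{s,t}(θ)| ≤ C t^n (t|θ|)^{-j}` whenever `t ≥ 1`, `V_{s,t}(0) ≥ κ t` and `0 < |θ| ≤ π`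
(the symbol estimate `(1+t²λ)^{j} λ^n |∂^n W_t| ≤ C` in the angle variable). [cite: Buchholz2016, Lemma 5.1 (5.3)] -/
theorem exists_abs_iteratedDeriv_acBump_le_tail {s : ℝ → ℝ} (hs : ∀ x, 0 ≤ s x)
    (hsm : ∀ k : ℕ, ContDiff ℝ k s) (hs0 : ∀ x, x ∉ Set.Icc (0 : ℝ) 1 → s x = 0) {κ : ℝ} (hκ : 0 < κ)
    (n j : ℕ) : ∃ C, 0 ≤ C ∧ ∀ t : ℕ, 1 ≤ t → κ * t ≤ profMass s t → ∀ θ : ℝ, θ ≠ 0 → |θ| ≤ π →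
      |iteratedDeriv n (acBump s t) θ| ≤ C * (t : ℝ) ^ n / ((t : ℝ) * |θ|) ^ j := by
  have hb : ∀ k : ℕ, ContDiff ℝ k (cprof s) := fun k => Complex.ofRealCLM.contDiff.comp (hsm k)
  have hb0 : ∀ x, x ∉ Set.Icc (0 : ℝ) 1 → cprof s x = 0 := fun x hx => by simp [cprof, hs0 x hx]
  have htail : ∀ i : ℕ, ∃ C, 0 ≤ C ∧ ∀ t : ℕ, 1 ≤ t → ∀ θ : ℝ, θ ≠ 0 → |θ| ≤ π →
      ‖profSum (cprof s) t i θ‖ ≤ C * (t : ℝ) ^ (i + 1) / ((t : ℝ) * |θ|) ^ j :=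
    fun i => exists_norm_profSum_le_tail hb hb0 i j
  choose C hC0 hC using htail
  set Cs : ℝ := ∑ i ∈ Finset.range (n + 1), (n.choose i : ℝ) * C i with hCs
  have hCs0 : 0 ≤ Cs := sum_nonneg fun i _ => mul_nonneg (Nat.cast_nonneg _) (hC0 i)
  refine ⟨Cs / κ, div_nonneg hCs0 hκ.le, fun t ht hmass θ hθ0 hθπ => ?_⟩
  have htpos : (0 : ℝ) < t := by exact_mod_cast ht
  have hM : 0 < profMass s t := lt_of_lt_of_le (by positivity) hmass
  have hden : 0 < ((t : ℝ) * |θ|) ^ j := by have := abs_pos.2 hθ0; positivity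
  refine (abs_iteratedDeriv_acBump_le_sum s t n θ).trans ?_
  have hterm : ∀ i ∈ Finset.range (n + 1), (n.choose i : ℝ) * ‖profSum (cprof s) t i θ‖ *
      ‖profSum (cprof s) t (n - i) (-θ)‖ ≤
      (n.choose i : ℝ) * C i * ((t : ℝ) ^ (n + 1) * profMass s t / ((t : ℝ) * |θ|) ^ j) := by
    intro i hi
    rw [Finset.mem_range] at hi
    have h1 := hC i t ht θ hθ0 hθπ
    have h2 := norm_profSum_cprof_le hs t (n - i) (-θ)
    rw [mul_assoc, mul_assoc]
    refine mul_le_mul_of_nonneg_left ?_ (Nat.cast_nonneg _)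
    calc ‖profSum (cprof s) t i θ‖ * ‖profSum (cprof s) t (n - i) (-θ)‖
        ≤ (C i * (t : ℝ) ^ (i + 1) / ((t : ℝ) * |θ|) ^ j) * ((t : ℝ) ^ (n - i) * profMass s t) :=
          mul_le_mul h1 h2 (norm_nonneg _) (by have := hC0 i; positivity)
      _ = C i * (((t : ℝ) ^ (i + 1) * (t : ℝ) ^ (n - i)) * profMass s t / ((t : ℝ) * |θ|) ^ j) := by ring
      _ = C i * ((t : ℝ) ^ (n + 1) * profMass s t / ((t : ℝ) * |θ|) ^ j) := by
          rw [← pow_add, show i + 1 + (n - i) = n + 1 by omega]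
  have hsum : ∑ i ∈ Finset.range (n + 1),
      (n.choose i : ℝ) * C i * ((t : ℝ) ^ (n + 1) * profMass s t / ((t : ℝ) * |θ|) ^ j) =
      Cs * ((t : ℝ) ^ (n + 1) * profMass s t / ((t : ℝ) * |θ|) ^ j) := by
    rw [hCs, sum_mul]
  calc (profMass s t ^ 2)⁻¹ * ∑ i ∈ Finset.range (n + 1),
        (n.choose i : ℝ) * ‖profSum (cprof s) t i θ‖ * ‖profSum (cprof s) t (n - i) (-θ)‖
      ≤ (profMass s t ^ 2)⁻¹ * ∑ i ∈ Finset.range (n + 1),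
          (n.choose i : ℝ) * C i * ((t : ℝ) ^ (n + 1) * profMass s t / ((t : ℝ) * |θ|) ^ j) :=
        mul_le_mul_of_nonneg_left (sum_le_sum hterm) (by positivity)
    _ = Cs * (t : ℝ) ^ (n + 1) / (profMass s t * ((t : ℝ) * |θ|) ^ j) := by
        rw [hsum]; field_simp
    _ ≤ Cs * (t : ℝ) ^ (n + 1) / ((κ * t) * ((t : ℝ) * |θ|) ^ j) :=
        div_le_div_of_nonneg_left (by positivity) (by positivity) (mul_le_mul_of_nonneg_right hmass hden.le)
    _ = Cs / κ * (t : ℝ) ^ n / ((t : ℝ) * |θ|) ^ j := by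
        field_simp
        ring

/-- `A_{s,t}` is smooth. [cite: Bauerschmidt2013, Lemma 2.3] -/
theorem contDiff_acBump (s : ℝ → ℝ) (t : ℕ) {n : WithTop ℕ∞} : ContDiff ℝ n (acBump s t) := by
  have hfun : acBump s t = fun θ => (profMass s t ^ 2)⁻¹ *
      (profSum (cprof s) t 0 θ * profSum (cprof s) t 0 (-θ)).re := by
    funext θ; rw [acBump_eq_re, div_eq_inv_mul]
  rw [hfun]
  exact contDiff_const.mul (Complex.reCLM.contDiff.comp
    ((contDiff_profSum (cprof s) t 0).mul ((contDiff_profSum (cprof s) t 0).comp contDiff_neg)))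

/-! ## The smooth plateau profile -/

/-- The smooth plateau profile `s(x) = σ(4x) σ(4 − 4x)` (`σ` = `Real.smoothTransition`): smooth, values in
`[0,1]`, `= 1` on `[1/4, 3/4]`, `= 0` off `(0,1)` — a compactly supported smooth bump as Bauerschmidt's `κ̂`.
[cite: Bauerschmidt2013, §3.1 (choice of κ)] -/
def plateau (x : ℝ) : ℝ := Real.smoothTransition (4 * x) * Real.smoothTransition (4 - 4 * x)

/-- `plateau` is smooth. [cite: Bauerschmidt2013, §3.1 (choice of κ)] -/
theorem contDiff_plateau (n : ℕ) : ContDiff ℝ n plateau :=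
  (Real.smoothTransition.contDiff.comp (contDiff_const.mul contDiff_id)).mul
    (Real.smoothTransition.contDiff.comp (contDiff_const.sub (contDiff_const.mul contDiff_id)))

/-- `0 ≤ plateau`. [cite: Bauerschmidt2013, §3.1 (choice of κ)] -/
theorem plateau_nonneg (x : ℝ) : 0 ≤ plateau x :=
  mul_nonneg (Real.smoothTransition.nonneg _) (Real.smoothTransition.nonneg _)

/-- `plateau ≤ 1`. [cite: Bauerschmidt2013, §3.1 (choice of κ)] -/
theorem plateau_le_one (x : ℝ) : plateau x ≤ 1 :=
  mul_le_one₀ (Real.smoothTransition.le_one _) (Real.smoothTransition.nonneg _)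
    (Real.smoothTransition.le_one _)

/-- `plateau = 1` on `[1/4, 3/4]`. [cite: Bauerschmidt2013, §3.1 (choice of κ)] -/
theorem plateau_eq_one {x : ℝ} (h1 : 1 / 4 ≤ x) (h2 : x ≤ 3 / 4) : plateau x = 1 := by
  unfold plateau
  rw [Real.smoothTransition.one_of_one_le (by linarith), Real.smoothTransition.one_of_one_le (by linarith),
    mul_one]

/-- `plateau = 0` off `[0,1]` (indeed off `(0,1)`). [cite: Bauerschmidt2013, §3.1 (choice of κ)] -/
theorem plateau_eq_zero {x : ℝ} (hx : x ∉ Set.Icc (0 : ℝ) 1) : plateau x = 0 := by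
  unfold plateau
  rw [Set.mem_Icc, not_and_or, not_le, not_le] at hx
  rcases hx with h | h
  · rw [Real.smoothTransition.zero_of_nonpos (by linarith), zero_mul]
  · rw [Real.smoothTransition.zero_of_nonpos (show 4 - 4 * x ≤ 0 by linarith), mul_zero]

/-- **Mass of the plateau profile**: `Σ_{ν=0}^t plateau(ν/t) ≥ t/4` for `t ≥ 2` (the integers in
`[t/4, 3t/4]` number at least `⌊t/2⌋ ≥ t/4`). [cite: Bauerschmidt2013, §3.1 (choice of κ)] -/
theorem profMass_plateau_ge {t : ℕ} (ht : 2 ≤ t) : (t : ℝ) / 4 ≤ profMass plateau t := by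
  have htpos : (0 : ℝ) < t := by exact_mod_cast (show 0 < t by omega)
  -- the block of integers `a, …, a + t/2 - 1` with `a = ⌈t/4⌉`
  set a : ℕ := (t + 3) / 4 with ha
  set b : ℕ := a + t / 2 - 1 with hb
  have hab : a ≤ b := by omega
  have hsub : Finset.Icc (a : ℤ) b ⊆ Finset.Icc (0 : ℤ) t := by
    intro ν hν
    rw [Finset.mem_Icc] at hν ⊢
    constructor <;> omega
  have hone : ∀ ν ∈ Finset.Icc (a : ℤ) b, plateau ((ν : ℝ) / t) = 1 := by
    intro ν hν
    rw [Finset.mem_Icc] at hν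
    have h4a : t ≤ 4 * a := by omega
    have h4b : 4 * b ≤ 3 * t := by omega
    refine plateau_eq_one ?_ ?_
    · rw [le_div_iff₀ htpos]
      have : (t : ℝ) ≤ 4 * (a : ℝ) := by exact_mod_cast h4a
      have : ((a : ℤ) : ℝ) ≤ ν := by exact_mod_cast hν.1
      push_cast at *; linarith
    · rw [div_le_iff₀ htpos]
      have : 4 * (b : ℝ) ≤ 3 * (t : ℝ) := by exact_mod_cast h4b
      have : (ν : ℝ) ≤ ((b : ℤ) : ℝ) := by exact_mod_cast hν.2
      push_cast at *; linarith
  have hcard : ((Finset.Icc (a : ℤ) b).card : ℝ) = (t / 2 : ℕ) := by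
    rw [Int.card_Icc]
    have : ((b : ℤ) + 1 - a).toNat = t / 2 := by omega
    rw [this]
  calc (t : ℝ) / 4 ≤ ((t / 2 : ℕ) : ℝ) := by
        have h := Nat.div_mul_le_self t 2
        have h' : t ≤ 2 * (t / 2) + 1 := by omega
        have : (t : ℝ) ≤ 2 * ((t / 2 : ℕ) : ℝ) + 1 := by exact_mod_cast h'
        have h2 : (1 : ℝ) ≤ ((t / 2 : ℕ) : ℝ) := by exact_mod_cast (show 1 ≤ t / 2 by omega)
        linarith
    _ = ∑ ν ∈ Finset.Icc (a : ℤ) b, plateau ((ν : ℝ) / t) := by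
        rw [sum_congr rfl hone, sum_const, nsmul_eq_mul, mul_one, hcard]
    _ ≤ profMass plateau t := sum_le_sum_of_subset_of_nonneg hsub fun ν _ _ => plateau_nonneg _

end Literature.Analysis.Fourier

end
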